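import Mathlib.Algebra.BigOperators.Fin
import HarnessLib

/-!
# Venture HSemireg — the WEIGHTED fibre partition FAILS at THEOREM F's tier (PROPOSITION H⁻)

Companion to `Summits/Ventures/HSemireg/FibrePartition.lean` (kernel form of THEOREM F, cell
pub-hsemireg, seat p2 gen 12): there, eight abstract incidence axioms (`balA`, `fanA`, `fanA'`,
`crossA`, `crossA'`, `rowA`, `rowA'`, `pairAA'`) force every slot-3 fibre `F ℓ L` to be BALANCED
(each slope equally often).  The cell's next question (p2 gen 13, `p2/wlaws/WEIGHTED-LOCAL-p2g13.md`
§9e–§9f, «THEOREM H») is the WEIGHTED analogue: give every triple `(ℓ,L,m)` a multiplicity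
`wT ℓ L m ≥ 1` and every pad a multiplicity `wA p m`, `wA' q m`, and ask whether the ADDITIVE TRANSFER
LAW at every pad-pair curve — «the two pads carry the same total weight as the two crossed triples»,
which is exactly what local commutative algebra grants up to multiplicity 2 (THEOREM G of that note) —
together with the weighted W-law (W3) at the A- and A′-systems forces every fibre to be balanced WITH
WEIGHTS (`∑_{m ∈ F ℓ L, slope m = c} wT ℓ L m` independent of `c`).  On the skeleton support of record
K1x this holds as an exact linear identity (note §9f).  THIS FILE shows it is NOT a consequence of the
axioms: `weighted_fibre_balance_fails` refutes the universally quantified weighted claim by a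
twelve-piece model (PROPOSITION H⁻ of the note, §9f v5.7) — one grid point `p`, one grid point `q`,
two slot-1 lines and two slot-2 lines through them, three slot-3 lines `m₀, m₁, m₂` of the three
slopes, the triples `(ℓ,L,m_i)` and their crossed partners `(ℓ*,L*,m_i)`, both pads at every `m_i`;
weights `wT ℓ L = (2,1,1)`, `wT ℓ* L* = (1,2,2)`, `wA = 1`, `wA' = 2` — additive at all three curves
(`1 + 2 = 2 + 1 = 1 + 2`), weighted-(W3) at both systems, all weights in `{1, 2}`, every axiom of
`fibre_balanced` true at EVERY pair `(ℓ, L)`, and the fibre over `(ℓ, L)` has weighted slope counts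
`2, 1, 1`.  (Geometrically the model sits inside the universe U(3|1) with `ℓ, L` sloped and `ℓ*` an
axis line, and its three local patterns `(1,2,1,2)`, `(1,1,2,2)`, `(1,1,2,2)` are complete
intersections by THEOREM G (d); none of that geometry is formalised here.)

WHAT THIS SAYS. Any «additive ⇒ weighted class-death» theorem (THEOREM H) must carry GLOBAL
hypotheses on the support beyond THEOREM F's tier — on K1x: every pad lies on 54 ∕ 54 ∕ 36 pad-pair
curves whose Weil members are class-balanced, and a Weil triple's crossed partner carries an axis line.

HONEST FRAMING. Finite combinatorics only (a counter-model to an implication between abstract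
incidence statements); no variety, cycle, cohomology class or semiregularity map occurs; nothing here
bears on HC ∕ HC_CM ∕ HC_AV.
-/

namespace Summit.Ventures.HSemireg
namespace WeightedFibreCounterexample

open Finset

/-- **PROPOSITION H⁻ (kernel form): the weighted fibre partition fails at THEOREM F's tier.**
The following WEIGHTED FIBRE-PARTITION CLAIM is FALSE: «for all incidence data satisfying the eight
axioms of `FibrePartition.fibre_balanced` (here even at EVERY pair `(ℓ, L)`), all weights in `{1, 2}`
on triples (`wT`) and pads (`wA`, `wA'`) that satisfy the weighted W-law (W3) at every A-system and
every A′-system and the ADDITIVE TRANSFER LAW `wA p m + wA' q m = wT ℓ L m + wT ℓ' L' m` at every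
crossed pad-pair configuration, every fibre is balanced with weights».  Counter-model (twelve pieces):
`M = Fin 3` (slope = id), one point in each of `P₁`, `P₂` lying on both lines of `L₁ = L₂ = Fin 2`,
fibres `F ℓ L = univ` if `ℓ = L` and `∅` otherwise (the triples `(0,0,m)` and their crossed partners
`(1,1,m)`), full A- and A′-systems, `wT 0 0 = (2,1,1)`, `wT 1 1 = (1,2,2)`, `wA = 1`, `wA' = 2`:
every hypothesis holds (checked by `decide`) and the fibre over `(0,0)` has weighted slope counts
`2 ≠ 1`. -/
theorem weighted_fibre_balance_fails :
    ¬ (∀ (M P₁ P₂ L₁ L₂ : Type) [DecidableEq M]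
        (on₁ : P₁ → L₁ → Prop) (on₂ : P₂ → L₂ → Prop)
        (F : L₁ → L₂ → Finset M) (SA : P₁ → Finset M) (SA' : P₂ → Finset M) (slope : M → Fin 3)
        (wT : L₁ → L₂ → M → ℕ) (wA : P₁ → M → ℕ) (wA' : P₂ → M → ℕ),
        -- the eight axioms of `fibre_balanced` (balA, fanA, fanA', crossA, crossA', rowA, rowA', pairAA')
        (∀ (p : P₁) (c c' : Fin 3),
          ((SA p).filter fun m => slope m = c).card = ((SA p).filter fun m => slope m = c').card) →
        (∀ (ℓ₀ : L₁) (L₀ : L₂) (m : M) (p : P₁) (m' : M),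
          m ∈ F ℓ₀ L₀ → on₁ p ℓ₀ → m ∈ SA p → m' ∈ SA p → slope m' ≠ slope m → m' ∈ F ℓ₀ L₀) →
        (∀ (ℓ₀ : L₁) (L₀ : L₂) (m : M) (q : P₂) (m' : M),
          m ∈ F ℓ₀ L₀ → on₂ q L₀ → m ∈ SA' q → m' ∈ SA' q → slope m' ≠ slope m → m' ∈ F ℓ₀ L₀) →
        (∀ (ℓ₀ ℓ' : L₁) (L₀ L' : L₂) (m : M) (p : P₁) (q : P₂),
          ℓ' ≠ ℓ₀ → L' ≠ L₀ → on₁ p ℓ₀ → on₁ p ℓ' → on₂ q L₀ → on₂ q L' →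
            m ∈ F ℓ₀ L₀ → m ∈ F ℓ' L' → m ∈ SA p → m ∈ SA' q) →
        (∀ (ℓ₀ ℓ' : L₁) (L₀ L' : L₂) (m : M) (p : P₁) (q : P₂),
          ℓ' ≠ ℓ₀ → L' ≠ L₀ → on₁ p ℓ₀ → on₁ p ℓ' → on₂ q L₀ → on₂ q L' →
            m ∈ F ℓ₀ L₀ → m ∈ F ℓ' L' → m ∈ SA' q → m ∈ SA p) →
        (∀ (ℓ : L₁) (L : L₂) (m : M), m ∈ F ℓ L → ∃ p, on₁ p ℓ ∧ m ∈ SA p) →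
        (∀ (ℓ : L₁) (L : L₂) (m : M), m ∈ F ℓ L → ∃ q, on₂ q L ∧ m ∈ SA' q) →
        (∀ (ℓ : L₁) (L : L₂) (m : M) (p : P₁) (q : P₂),
          m ∈ F ℓ L → on₁ p ℓ → on₂ q L → m ∈ SA p → m ∈ SA' q →
            ∃ ℓ' L', ℓ' ≠ ℓ ∧ L' ≠ L ∧ on₁ p ℓ' ∧ on₂ q L' ∧ m ∈ F ℓ' L') →
        -- weights in {1, 2}
        (∀ (ℓ : L₁) (L : L₂) (m : M), 1 ≤ wT ℓ L m ∧ wT ℓ L m ≤ 2) →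
        (∀ (p : P₁) (m : M), 1 ≤ wA p m ∧ wA p m ≤ 2) →
        (∀ (q : P₂) (m : M), 1 ≤ wA' q m ∧ wA' q m ≤ 2) →
        -- weighted (W3) at every A-system and every A′-system
        (∀ (p : P₁) (c c' : Fin 3),
          ∑ m ∈ (SA p).filter (fun m => slope m = c), wA p m
            = ∑ m ∈ (SA p).filter (fun m => slope m = c'), wA p m) →
        (∀ (q : P₂) (c c' : Fin 3),
          ∑ m ∈ (SA' q).filter (fun m => slope m = c), wA' q m
            = ∑ m ∈ (SA' q).filter (fun m => slope m = c'), wA' q m) →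
        -- the ADDITIVE TRANSFER LAW at every crossed pad-pair configuration
        (∀ (ℓ ℓ' : L₁) (L L' : L₂) (m : M) (p : P₁) (q : P₂),
          ℓ' ≠ ℓ → L' ≠ L → on₁ p ℓ → on₁ p ℓ' → on₂ q L → on₂ q L' →
            m ∈ F ℓ L → m ∈ F ℓ' L' → m ∈ SA p → m ∈ SA' q →
              wA p m + wA' q m = wT ℓ L m + wT ℓ' L' m) →
        -- hoped-for conclusion: every fibre balanced WITH WEIGHTS
        ∀ (ℓ : L₁) (L : L₂) (c c' : Fin 3),
          ∑ m ∈ (F ℓ L).filter (fun m => slope m = c), wT ℓ L m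
            = ∑ m ∈ (F ℓ L).filter (fun m => slope m = c'), wT ℓ L m) := by
  intro h
  -- the twelve-piece model: M = Fin 3, P₁ = P₂ = Unit, L₁ = L₂ = Fin 2, full incidence
  have key := h (Fin 3) Unit Unit (Fin 2) (Fin 2) (fun _ _ => True) (fun _ _ => True)
    (fun ℓ L => if ℓ = L then univ else ∅) (fun _ => univ) (fun _ => univ) id
    (fun ℓ _ m => if ℓ = 0 then (if m = 0 then 2 else 1) else (if m = 0 then 1 else 2))
    (fun _ _ => 1) (fun _ _ => 2)
    (by decide) (by decide) (by decide)
    (by intros; exact mem_univ _) (by intros; exact mem_univ _)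
    (by decide) (by decide)
    (by
      intro ℓ L m p q hm _ _ _ _
      refine ⟨ℓ + 1, L + 1, ?_, ?_, trivial, trivial, ?_⟩
      · clear hm; revert ℓ; decide
      · clear hm; revert L; decide
      · revert hm; revert m; revert L; revert ℓ; decide)
    (by decide) (by decide) (by decide) (by decide) (by decide)
    (by
      intro ℓ ℓ' L L' m p q h₁ h₂ _ _ _ _ hm hm' _ _
      revert h₁ h₂ hm hm'; revert m; revert L'; revert L; revert ℓ'; revert ℓ
      decide)
    0 0 0 1
  simp [Finset.sum_filter] at key

end WeightedFibreCounterexample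
end Summit.Ventures.HSemireg
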